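import Summits.AtomisticToContinuum.BoseEinsteinCondensation.Theses.BECStronglyRayleigh

/-!
# Sketch — crux idea `coarse-cell-hardcore-floor` for LatticeToPeriodicBridge (stmt-AtomisticToContinuum-9674)

Ideator k = 2, round 1. Objects and first lemmas of the line; nothing here is a route item.

Dictionary. Torus of side `L`, grid of `M³` half-open cells of side `b = L/M`, flat cell modes
`χ_m = b^{-3/2} 1_{C_m}`. Since `constantMode L = M^{-3/2} Σ_m χ_m`, the continuum condensate
occupation `⟨φ₀, γ_Ψ φ₀⟩` IS the zero-quasimomentum occupation `M⁻³ Σ_{m,m'} ⟨χ_m, γ_Ψ χ_{m'}⟩` of the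
coarse-grained one-body density matrix — at every scale. `H = KineticLatticeBEC` bounds exactly this
functional for the hard-core lattice ground state: `xyZeroModeWeight M N = ⟨S⁺_tot S⁻_tot⟩ = M³ n₀^XY`.
-/

noncomputable section

open MeasureTheory Filter
open scoped ENNReal NNReal ComplexConjugate BigOperators

namespace Summit.AtomisticToContinuum.BoseEinsteinCondensation.Cruxes.LatticeToPeriodicBridge.CoarseCellHardcoreFloor

open Literature.MathematicalPhysics.QuantumManyBody.BoseGas
open Literature.MathematicalPhysics.QuantumLattice
open Summit.AtomisticToContinuum.BoseEinsteinCondensation.Theses.BECStronglyRayleigh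

/-- The half-open cell `∏_j [m_j b, (m_j+1) b)`, `b = L/M`, of the `M`-grid of `[0,L)³`. -/
def gridCell (L : ℝ) (M : ℕ) (m : Fin 3 → Fin M) : Set Space :=
  {x : Space | ∀ j, x j ∈ Set.Ico (((m j : ℕ) : ℝ) * (L / M)) ((((m j : ℕ) : ℝ) + 1) * (L / M))}

/-- The `L²`-normalised flat mode `b^{-3/2} 1_{C_m}` of a grid cell. -/
def gridMode (L : ℝ) (M : ℕ) (m : Fin 3 → Fin M) : Space → ℂ :=
  (gridCell L M m).indicator fun _ => ((Real.sqrt ((L / M) ^ 3))⁻¹ : ℂ)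

/-- Nearest neighbour of the multi-index `m` in direction `j` (periodic wrap in `Fin M`). -/
def nbr {M : ℕ} [NeZero M] (m : Fin 3 → Fin M) (j : Fin 3) : Fin 3 → Fin M :=
  Function.update m j (m j + 1)

/-- Coarse amplitude of particle 1 in the cell mode `χ_m`, the other `n` particles frozen at `Y`:
`A_m(Y) = ∫ conj(χ_m)(x) Ψ(x, Y) dx`. -/
def coarseAmp {n : ℕ} (L : ℝ) (M : ℕ) (m : Fin 3 → Fin M) (Ψ : Config (n + 1) → ℂ)
    (Y : Config n) : ℂ :=
  ∫ x, conj (gridMode L M m x) * Ψ (Matrix.vecCons x Y)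

/-- Cubic-lattice HOPPING DEFICIT of the coarse-grained state (hopping `t = 1`):
`D = N ∫ dY Σ_m Σ_j |A_m(Y) − A_{m+e_j}(Y)|²` = `⟨Ψ, dΓ(Π_χ^* (graph Laplacian) Π_χ) Ψ⟩`. -/
def hoppingDeficit (n : ℕ) (L : ℝ) (M : ℕ) [NeZero M] (Ψ : Config (n + 1) → ℂ) : ℝ≥0∞ :=
  (n + 1 : ℝ≥0∞) * ∫⁻ Y in cellN n L, ∑ m : Fin 3 → Fin M, ∑ j : Fin 3,
    (‖coarseAmp L M m Ψ Y - coarseAmp L M (nbr m j) Ψ Y‖₊ : ℝ≥0∞) ^ 2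

/-- Coarse coherent sum `Σ_m ⟨χ_m, γ_Ψ χ_m⟩` = number of particles in flat cell modes (`= N_b`). -/
def gridCohSum (N : ℕ) (L : ℝ) (M : ℕ) (Ψ : Config N → ℂ) : ℝ≥0∞ :=
  ∑ m : Fin 3 → Fin M, occupation N (gridMode L M m) Ψ

/-- `H`'s functional verbatim: `⟨S⁺_tot S⁻_tot⟩ = ⟨(S¹_tot)² + (S²_tot)²⟩ + N − M³/2` in the tracial
ground state of the penalised XY Hamiltonian on `(ℤ/M)³` (= sector-`N` hard-core ground state), i.e.
`M³ ·` (zero-quasimomentum occupation of hard-core lattice bosons at filling `N/M³`). -/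
def xyZeroModeWeight (M : ℕ) [NeZero M] (N : ℕ) : ℝ :=
  ((xyTorus 3 M 1 + (((3 + 1) * M ^ 3 : ℕ) : ℂ) •
      (totalSpin 1 2 + ((M : ℂ) ^ 3 / 2 - (N : ℂ)) • 1) ^ 2).groundStateFunctional
    (totalSpin 1 0 * totalSpin 1 0 + totalSpin 1 1 * totalSpin 1 1)).re + N - (M : ℝ) ^ 3 / 2

/-! ### First lemmas (provable now; Poincaré–Wirtinger / FTC + Cauchy–Schwarz, Bose symmetry) -/

/-- FIRST LEMMA (a): particles outside the flat cell modes cost kinetic energy —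
`N − Σ_m ⟨χ_m, γ_Ψ χ_m⟩ ≤ (b²/π²) · T(Ψ)` (Neumann gap `(π/b)²` of a cube of side `b`, per cell, per
slice; then Bose symmetry `N ∫|∇₁Ψ|² = T`). With `T ≤ E₀ + δ ≲ 4πaρN`: all but `O(ρab²)N` particles
live in the `M³` coarse modes. -/
def CoarseModesCarryAlmostAll : Prop :=
  ∀ (N M : ℕ) (L : ℝ), 0 < L → 0 < M → ∀ Ψ : PeriodicTrialState N L,
    (N : ℝ≥0∞) ≤ gridCohSum N L M ((cellN N L).indicator Ψ.ψ) +
      ENNReal.ofReal ((L / M) ^ 2 / Real.pi ^ 2) * ∫⁻ X in cellN N L, kineticDensity Ψ.ψ X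

/-- FIRST LEMMA (b), CROSS-CELL POINCARÉ: the coarse state's cubic hopping deficit is dominated by the
continuum kinetic energy, `D ≤ 2 b² T(Ψ)` (`f̄_{m+e_j} − f̄_m = b⁻³∫_{C_m}∫₀^b ∂_j f`, Cauchy–Schwarz,
each cell counted twice per direction). Hence the continuum near-minimiser, seen on the `M`-grid, is a
lattice boson state with hopping-energy excess `≤ 2b²(E₀+δ) ≈ 8π ν^{2/3}(ρa³)^{1/3} N → 0` per
particle in units of `t`: an almost perfectly nearest-neighbour-coherent lattice gas at filling
`ν = N/M³`. -/
def CrossCellPoincare : Prop :=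
  ∀ (n M : ℕ) [NeZero M] (L : ℝ), 0 < L → ∀ Ψ : PeriodicTrialState (n + 1) L,
    hoppingDeficit n L M Ψ.ψ ≤
      ENNReal.ofReal (2 * (L / M) ^ 2) * ∫⁻ X in cellN (n + 1) L, kineticDensity Ψ.ψ X

/-! ### The bet -/

/-- THE BET `CoarseHardCoreFloor` (weakest, "half-filling sliver" form): on the grid of `M³` cells with
`M` even and `2N ≤ M³ ≤ 2N + 7M²` (such `M` always exists, `exists_even_sliver`; filling
`ν = N/M³ ∈ [1/2 − 7/(2M), 1/2]`, cell side `b = L/M = (2ρ)^{-1/3}(1 + O(N^{-1/3}))` = the interparticle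
scale), the constant-mode occupation of a periodic `δ`-near-minimiser of the dilute gas is at least
`(1−η)` times the zero-quasimomentum occupation `M⁻³ · xyZeroModeWeight M N` of the hard-core lattice
ground state at the same `(M, N)`, up to `ηN`, once `ρ < ρ₀(v, η)`. By Tóth's ceiling
`xyZeroModeWeight M N ≤ N(M³ − N + 1)` the right side is `≤ (1−η)(N/2 + O(N^{2/3}))`: the bet is implied
by "torus condensate FRACTION ≥ 1/2 + 2η at small density" and implies, fed with `H` (`≥ cNM³`),
PeriodicBEC with constant `(1−η)c − η` (`latticeToPeriodicBridge_of_floor`, kernel-checked below). -/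
def CoarseHardCoreFloor : Prop :=
  ∀ v : ℝ → ℝ≥0∞, IsRepulsiveFiniteRange v → ∀ η : ℝ, 0 < η →
    ∃ ρ₀ : ℝ, 0 < ρ₀ ∧ ∀ ρ : ℝ, 0 < ρ → ρ < ρ₀ → ∀ᶠ N : ℕ in atTop, ∃ δ : ℝ≥0∞, 0 < δ ∧
      ∀ Ψ : PeriodicTrialState N (sideLength ρ N),
        periodicEnergy v Ψ ≤ periodicGroundStateEnergy v N (sideLength ρ N) + δ →
        ∀ (M : ℕ) [NeZero M], Even M → 2 * N ≤ M ^ 3 → M ^ 3 ≤ 2 * N + 7 * M ^ 2 →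
          ENNReal.ofReal ((1 - η) / (M : ℝ) ^ 3 * xyZeroModeWeight M N) ≤
            condensateOccupation N (sideLength ρ N) Ψ.ψ + ENNReal.ofReal (η * N)

/-- The comparison grid exists for every `N ≥ 1`: an even `M ≥ 2` with `2N ≤ M³ ≤ 2N + 7M²`
(take the least `M₁` with `M₁³ ≥ 2N` and round up to even; `(M₁+1)³ − (M₁−1)³ = 6M₁² + 2`). -/
theorem exists_even_sliver {N : ℕ} (hN : 1 ≤ N) :
    ∃ M : ℕ, Even M ∧ 2 ≤ M ∧ 2 * N ≤ M ^ 3 ∧ M ^ 3 ≤ 2 * N + 7 * M ^ 2 := by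
  classical
  have hex : ∃ M : ℕ, 2 * N ≤ M ^ 3 := ⟨2 * N, by
    calc 2 * N = (2 * N) ^ 1 := (pow_one _).symm
      _ ≤ (2 * N) ^ 3 := Nat.pow_le_pow_right (by omega) (by norm_num)⟩
  have hspec : 2 * N ≤ Nat.find hex ^ 3 := Nat.find_spec hex
  have hmin' : ∀ m, m < Nat.find hex → ¬ 2 * N ≤ m ^ 3 := fun m hm => Nat.find_min hex hm
  generalize Nat.find hex = M₁ at hspec hmin'
  have hM₁2 : 2 ≤ M₁ := by
    by_contra hlt
    push Not at hlt
    have h3 : M₁ ^ 3 ≤ 1 := by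
      calc M₁ ^ 3 ≤ 1 ^ 3 := Nat.pow_le_pow_left (by omega) 3
        _ = 1 := by norm_num
    omega
  obtain ⟨k, rfl⟩ : ∃ k, M₁ = k + 1 := ⟨M₁ - 1, by omega⟩
  have hmin : ¬ 2 * N ≤ k ^ 3 := hmin' k (by omega)
  push Not at hmin
  rcases Nat.even_or_odd (k + 1) with heven | hodd
  · refine ⟨k + 1, heven, hM₁2, hspec, ?_⟩
    nlinarith [hmin]
  · refine ⟨k + 2, ?_, by omega, ?_, ?_⟩
    · rcases hodd with ⟨j, hj⟩
      exact ⟨j + 1, by omega⟩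
    · calc 2 * N ≤ (k + 1) ^ 3 := hspec
        _ ≤ (k + 2) ^ 3 := Nat.pow_le_pow_left (by omega) 3
    · nlinarith [hmin]

/-- COMPOSITION (kernel-checked): the bet plus `H` decides the crux by name.
`η := min (c/4) (1/2)`; grid `M` from `exists_even_sliver` (so `M ≥ L₀` once `N ≥ L₀³`);
`(1−η)c − η ≥ c/4`. -/
theorem latticeToPeriodicBridge_of_floor (hF : CoarseHardCoreFloor) : LatticeToPeriodicBridge := by
  intro hH v hv
  obtain ⟨c, hc, L₀, hHL⟩ := hH
  set η : ℝ := min (c / 4) (1 / 2) with hηdef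
  have hη0 : 0 < η := lt_min (by positivity) (by norm_num)
  have hηc : η ≤ c / 4 := min_le_left _ _
  have hηh : η ≤ 1 / 2 := min_le_right _ _
  obtain ⟨ρ₀, hρ₀, hρ⟩ := hF v hv η hη0
  refine ⟨ρ₀, hρ₀, fun ρ hρpos hρlt => ⟨c / 4, by positivity, ?_⟩⟩
  filter_upwards [hρ ρ hρpos hρlt, eventually_ge_atTop (max 1 (L₀ ^ 3))] with N hN hNlarge
  obtain ⟨δ, hδ, hΨ⟩ := hN
  refine ⟨δ, hδ, fun Ψ hE => ?_⟩
  have hN1 : 1 ≤ N := le_trans (le_max_left _ _) hNlarge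
  have hNL : L₀ ^ 3 ≤ N := le_trans (le_max_right _ _) hNlarge
  obtain ⟨M, hEven, hM2, h2N, hwin⟩ := exists_even_sliver hN1
  have hL₀M : L₀ ≤ M := by
    by_contra hlt
    push Not at hlt
    have : M ^ 3 < L₀ ^ 3 := Nat.pow_lt_pow_left hlt (by norm_num)
    omega
  haveI : NeZero M := ⟨by omega⟩
  -- the two inputs
  have hfloor := hΨ Ψ hE M hEven h2N hwin
  have hlat : c * N * (M : ℝ) ^ 3 ≤ xyZeroModeWeight M N := hHL M hL₀M hEven N hN1 h2N
  -- arithmetic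
  have hMpos : (0 : ℝ) < (M : ℝ) ^ 3 := by positivity
  have h1η : 0 < 1 - η := by linarith
  have hkey : c / 4 * N + η * N ≤ (1 - η) / (M : ℝ) ^ 3 * xyZeroModeWeight M N := by
    have h1 : (1 - η) * (c * N) ≤ (1 - η) / (M : ℝ) ^ 3 * xyZeroModeWeight M N := by
      rw [div_mul_eq_mul_div, le_div_iff₀ hMpos]
      calc (1 - η) * (c * N) * (M : ℝ) ^ 3 = (1 - η) * (c * N * (M : ℝ) ^ 3) := by ring
        _ ≤ (1 - η) * xyZeroModeWeight M N := mul_le_mul_of_nonneg_left hlat h1η.le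
    have hN0 : (0 : ℝ) ≤ N := Nat.cast_nonneg N
    have hA : η * N ≤ c / 4 * N := mul_le_mul_of_nonneg_right hηc hN0
    have hB : η * (c * N) ≤ 1 / 2 * (c * N) := mul_le_mul_of_nonneg_right hηh (by positivity)
    have h2 : c / 4 * N + η * N ≤ (1 - η) * (c * N) := by nlinarith [hA, hB]
    exact h2.trans h1
  have hsum : ENNReal.ofReal (c / 4 * N) + ENNReal.ofReal (η * N) ≤
      condensateOccupation N (sideLength ρ N) Ψ.ψ + ENNReal.ofReal (η * N) := by
    rw [← ENNReal.ofReal_add (by positivity) (by positivity)]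
    exact (ENNReal.ofReal_le_ofReal hkey).trans hfloor
  exact (ENNReal.add_le_add_iff_right ENNReal.ofReal_ne_top).mp hsum

/-- Shape check: the bet is stated so that, with `H`, it concludes the crux BY NAME. -/
def FloorClosesBridge : Prop := CoarseHardCoreFloor → LatticeToPeriodicBridge

example : FloorClosesBridge = (CoarseHardCoreFloor → LatticeToPeriodicBridge) := rfl

end Summit.AtomisticToContinuum.BoseEinsteinCondensation.Cruxes.LatticeToPeriodicBridge.CoarseCellHardcoreFloor

end
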